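import Mathlib
import Literature.Analysis.FluidPDE.PartialRegularity
import Literature.Analysis.FluidPDE.LocalTypeI
import Literature.Analysis.FluidPDE.SuitableWeak
import Summits.NavierStokesRegularity.NavierStokesRegularity.Theorems.LandauTailLandauTailBlowupTypeII

/-!
# A Landau-tailed singular point is Type II in the tree's accepted vocabulary

Helper file for crux `LandauTailBlowup` (stmt-NavierStokesRegularity-1944), line `registered`,
registered stubs `landauTail_cknC_tendsto_top` (E0a), `landauTail_not_isTypeISingularPoint` (E1) and
`landauTail_not_isLocalTypeISingularPoint` (E2) of lead cycle c6.

Let `(u, p)` be a classical unit-viscosity solution of the unforced Navier–Stokes system on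
`ℝ³ × (−1, 0)` with the parabolic tail `√(−t) u(t, √(−t) y) → U y` (`y ≠ 0`) to a nonzero steady
`(−1)`-homogeneous profile `(U, P)` smooth off the origin (a witness of the body of `LandauTailLocal`).

* E0a: the scaled cubic quantity of Caffarelli–Kohn–Nirenberg at the cylinders centred at the
  singular point diverges, `cknC r (0,0) u = r⁻² ∫∫_{Q_r(0,0)} |u|³ → ∞` as `r → 0⁺` — the case `q = 3`
  of the momentum-flux theorem `landauTail_scaledNorm_tendsto_top` (p162027: `r^{q−5}∫∫_{Q_r}|u|^q → ∞`
  for every real `q > 2`), after the identifications `r^{3−5} = (r²)⁻¹` and `‖·‖ₑ ^ (3:ℝ) = ‖·‖ₑ ^ 3`.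
* E1: hence `(0,0)` is never a Type I singular point in the accepted centred sense
  `IsTypeISingularPoint` (Seregin–Šverák 2009), for any region `Q` and any pressure `π`:
  `sup_{0<r<r₀} (A + C + D + E)(r) ≥ C(r) → ∞`.
* E2: nor a local Type I singular point in Albritton–Barker's printed sense
  `IsLocalTypeISingularPoint`: `𝐈(Q_{r₀}(0,0)) ≥ (A + C + D + E)(Q_r(0,0)) ≥ C(r) → ∞` (`Q_r ⊆ Q_{r₀}` for
  `r ≤ r₀`).

References: L. Caffarelli, R. Kohn, L. Nirenberg, CPAM 35 (1982), §2 (scaled quantities);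
G. Seregin, V. Šverák, CPDE 34 (2009), §1 (Type I); D. Albritton, T. Barker, arXiv:1811.00502, §1;
G. Seregin, *Lecture Notes on Regularity Theory for the Navier–Stokes Equations* (2014), ch. 6.
-/

set_option linter.dupNamespace false

namespace Summit.NavierStokesRegularity.NavierStokesRegularity.Theorems

open MeasureTheory Set Filter Topology Metric
open scoped ENNReal NNReal
open Literature.Analysis.FluidPDE

/-- The CKN prefactor of `C(r)` is the `q = 3` prefactor of the scaled Lebesgue norms:
`ofReal (r ^ (3 − 5)) = (ofReal r ^ 2)⁻¹` for `r > 0`. [folklore] -/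
private theorem ofReal_rpow_three_sub_five {r : ℝ} (hr : 0 < r) :
    ENNReal.ofReal (r ^ ((3 : ℝ) - 5)) = (ENNReal.ofReal r ^ 2)⁻¹ := by
  rw [← ENNReal.ofReal_rpow_of_pos hr, show (3 : ℝ) - 5 = -(2 : ℝ) by norm_num, ENNReal.rpow_neg,
    ENNReal.rpow_two]

/-- `C(r) ≤ (A + C + D + E)(r)` for the accepted scaled quantities (`cknSum`). [folklore] -/
private theorem cknC_le_cknSum (r : ℝ) (z : ℝ × EuclideanSpace ℝ (Fin 3))
    (u : ℝ → EuclideanSpace ℝ (Fin 3) → EuclideanSpace ℝ (Fin 3))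
    (p : ℝ → EuclideanSpace ℝ (Fin 3) → ℝ)
    (G : ℝ → EuclideanSpace ℝ (Fin 3) → EuclideanSpace ℝ (Fin 3) →L[ℝ] EuclideanSpace ℝ (Fin 3)) :
    cknC r z u ≤ cknSum r z u p G := by
  rw [cknSum_def]
  exact le_add_self.trans (le_self_add.trans le_self_add)

/-- `C(Q(z, r)) ≤ (A + C + D + E)(Q(z, r))` for Albritton–Barker's printed quantities (`abScaledSum`).
[folklore] -/
private theorem cknC_le_abScaledSum (r : ℝ) (z : ℝ × EuclideanSpace ℝ (Fin 3))
    (u : ℝ → EuclideanSpace ℝ (Fin 3) → EuclideanSpace ℝ (Fin 3))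
    (p : ℝ → EuclideanSpace ℝ (Fin 3) → ℝ)
    (G : ℝ → EuclideanSpace ℝ (Fin 3) → EuclideanSpace ℝ (Fin 3) →L[ℝ] EuclideanSpace ℝ (Fin 3)) :
    cknC r z u ≤ abScaledSum r z u p G := by
  unfold abScaledSum
  exact le_add_self.trans (le_self_add.trans le_self_add)

/-- Backward parabolic cylinders with a common centre are monotone in the radius, `0 ≤ r ≤ r'`.
[folklore] -/
private theorem parabolicCylinder_mono_radius' {r r' : ℝ} (hr : 0 ≤ r) (h : r ≤ r')
    (z : ℝ × EuclideanSpace ℝ (Fin 3)) : parabolicCylinder r z ⊆ parabolicCylinder r' z := by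
  have h2 : r ^ 2 ≤ r' ^ 2 := pow_le_pow_left₀ hr h 2
  exact prod_mono (Ioo_subset_Ioo (by linarith) le_rfl) (ball_subset_ball h)

/-- **E0a — the scaled cubic quantity `C(r)` of CKN diverges at a Landau-tailed singular point**
(vocabulary bridge to `Fluid.cknC`): for every Landau-tailed local classical solution,
`cknC r (0,0) u = r⁻² ∫∫_{Q_r(0,0)} |u|³ → ∞` as `r → 0⁺` — the case `q = 3` of
`landauTail_scaledNorm_tendsto_top` (p162027), rewritten along `r > 0` with `r^{3−5} = (r²)⁻¹` in `ℝ≥0∞`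
and `‖·‖ₑ ^ (3:ℝ) = ‖·‖ₑ ^ 3`. (CKN 1982, §2; Seregin–Šverák 2009.) -/
theorem landauTail_cknC_tendsto_top : ∀ (u : ℝ → EuclideanSpace ℝ (Fin 3) → EuclideanSpace ℝ (Fin 3)) (p : ℝ → EuclideanSpace ℝ (Fin 3) → ℝ) (U : EuclideanSpace ℝ (Fin 3) → EuclideanSpace ℝ (Fin 3)) (P : EuclideanSpace ℝ (Fin 3) → ℝ), (ContDiffOn ℝ (⊤ : ℕ∞) U {0}ᶜ ∧ ContDiffOn ℝ (⊤ : ℕ∞) P {0}ᶜ ∧ (∀ x : EuclideanSpace ℝ (Fin 3), x ≠ 0 → Literature.Analysis.FluidPDE.convect U U x + gradient P x = (1 : ℝ) • Laplacian.laplacian U x) ∧ (∀ x : EuclideanSpace ℝ (Fin 3), x ≠ 0 → Literature.Analysis.FluidPDE.VectorCalculus.divergence U x = 0) ∧ (∀ c : ℝ, 0 < c → ∀ x : EuclideanSpace ℝ (Fin 3), U (c • x) = c⁻¹ • U x) ∧ (∃ x : EuclideanSpace ℝ (Fin 3), U x ≠ 0)) → Literature.Analysis.FluidPDE.IsClassicalNSSolutionOn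 (Set.Ioo (-1) 0) 1 0 u p → (∀ y : EuclideanSpace ℝ (Fin 3), y ≠ 0 → Filter.Tendsto (fun t : ℝ => Real.sqrt (0 - t) • u t (Real.sqrt (0 - t) • y)) (nhdsWithin 0 (Set.Iio 0)) (nhds (U y))) → Filter.Tendsto (fun r : ℝ => Literature.Analysis.FluidPDE.cknC r ((0 : ℝ), (0 : EuclideanSpace ℝ (Fin 3))) u) (nhdsWithin 0 (Set.Ioi 0)) (nhds ⊤) := by
  intro u p U P hprof hcl htail
  have h3 := landauTail_scaledNorm_tendsto_top u p U P hprof hcl htail 3 (by norm_num)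
  refine h3.congr' ?_
  filter_upwards [self_mem_nhdsWithin] with r hr
  rw [mem_Ioi] at hr
  unfold cknC
  rw [ofReal_rpow_three_sub_five hr]
  congr 1
  refine lintegral_congr fun z => ?_
  rw [show (3 : ℝ) = ((3 : ℕ) : ℝ) by norm_num, ENNReal.rpow_natCast]

/-- **E1 — a Landau-tailed singular point is never a Type I singular point in the accepted (Seregin–Šverák,
centred) sense `IsTypeISingularPoint`**, for ANY region `Q` and ANY pressure `π`: a Type I witness provides
`r₀ > 0` and a weak gradient `G` with `sup_{0<r<r₀} (A + C + D + E)(r, (0,0)) < ∞`, but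
`(A + C + D + E)(r) ≥ C(r) = cknC r (0,0) u → ∞` along `r → 0⁺` inside `(0, r₀)` (E0a), so the supremum is `⊤`.
In particular a Landau-tailed blow-up is never a witness of the registered open statement
`TypeISingularityExists`. -/
theorem landauTail_not_isTypeISingularPoint : ∀ (u : ℝ → EuclideanSpace ℝ (Fin 3) → EuclideanSpace ℝ (Fin 3)) (p : ℝ → EuclideanSpace ℝ (Fin 3) → ℝ) (U : EuclideanSpace ℝ (Fin 3) → EuclideanSpace ℝ (Fin 3)) (P : EuclideanSpace ℝ (Fin 3) → ℝ), (ContDiffOn ℝ (⊤ : ℕ∞) U {0}ᶜ ∧ ContDiffOn ℝ (⊤ : ℕ∞) P {0}ᶜ ∧ (∀ x : EuclideanSpace ℝ (Fin 3), x ≠ 0 → Literature.Analysis.FluidPDE.convect U U x + gradient P x = (1 : ℝ) • Laplacian.laplacian U x) ∧ (∀ x : EuclideanSpace ℝ (Fin 3), x ≠ 0 → Literature.Analysis.FluidPDE.VectorCalculus.divergence U x = 0) ∧ (∀ c : ℝ, 0 < c → ∀ x : EuclideanSpace ℝ (Fin 3), U (c • x) = c⁻¹ • U x) ∧ (∃ x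 : EuclideanSpace ℝ (Fin 3), U x ≠ 0)) → Literature.Analysis.FluidPDE.IsClassicalNSSolutionOn (Set.Ioo (-1) 0) 1 0 u p → (∀ y : EuclideanSpace ℝ (Fin 3), y ≠ 0 → Filter.Tendsto (fun t : ℝ => Real.sqrt (0 - t) • u t (Real.sqrt (0 - t) • y)) (nhdsWithin 0 (Set.Iio 0)) (nhds (U y))) → ∀ (Q : TopologicalSpace.Opens (ℝ × EuclideanSpace ℝ (Fin 3))) (π : ℝ → EuclideanSpace ℝ (Fin 3) → ℝ), ¬ Literature.Analysis.FluidPDE.IsTypeISingularPoint Q u π ((0 : ℝ), (0 : EuclideanSpace ℝ (Fin 3))) := by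
  intro u p U P hprof hcl htail Q π hT
  obtain ⟨-, -, G, -, r₀, hr₀, -, hsup⟩ := hT
  have hC := landauTail_cknC_tendsto_top u p U P hprof hcl htail
  rw [ENNReal.tendsto_nhds_top_iff_nnreal] at hC
  refine hsup.ne (ENNReal.eq_top_of_forall_nnreal_le fun M => ?_)
  obtain ⟨r, hMr, hr⟩ := ((hC M).and (Ioo_mem_nhdsGT hr₀)).exists
  calc (M : ℝ≥0∞) ≤ cknC r ((0 : ℝ), (0 : EuclideanSpace ℝ (Fin 3))) u := hMr.le
    _ ≤ cknSum r ((0 : ℝ), (0 : EuclideanSpace ℝ (Fin 3))) u π G := cknC_le_cknSum r _ u π G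
    _ ≤ ⨆ r ∈ Ioo 0 r₀, cknSum r ((0 : ℝ), (0 : EuclideanSpace ℝ (Fin 3))) u π G :=
        le_iSup₂ (f := fun r (_ : r ∈ Ioo 0 r₀) =>
          cknSum r ((0 : ℝ), (0 : EuclideanSpace ℝ (Fin 3))) u π G) r hr

/-- **E2 — nor a local Type I singular point in Albritton–Barker's printed sense `IsLocalTypeISingularPoint`**,
for ANY radius `r₀` and ANY pressure `π`: a witness provides `r₀ > 0` and a weak gradient `G` with
`𝐈(Q_{r₀}(0,0)) < ∞`, but every centred sub-ball `Q_r(0,0)`, `0 < r < r₀`, is admissible, so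
`𝐈(Q_{r₀}(0,0)) ≥ (A + C + D + E)(Q_r(0,0)) ≥ C(r) = cknC r (0,0) u → ∞` (E0a): the Type I quantity is `⊤`.
A Landau-tailed blow-up is never a witness of `LocalTypeISingularityExists`. -/
theorem landauTail_not_isLocalTypeISingularPoint : ∀ (u : ℝ → EuclideanSpace ℝ (Fin 3) → EuclideanSpace ℝ (Fin 3)) (p : ℝ → EuclideanSpace ℝ (Fin 3) → ℝ) (U : EuclideanSpace ℝ (Fin 3) → EuclideanSpace ℝ (Fin 3)) (P : EuclideanSpace ℝ (Fin 3) → ℝ), (ContDiffOn ℝ (⊤ : ℕ∞) U {0}ᶜ ∧ ContDiffOn ℝ (⊤ : ℕ∞) P {0}ᶜ ∧ (∀ x : EuclideanSpace ℝ (Fin 3), x ≠ 0 → Literature.Analysis.FluidPDE.convect U U x + gradient P x = (1 : ℝ) • Laplacian.laplacian U x) ∧ (∀ x : EuclideanSpace ℝ (Fin 3), x ≠ 0 → Literature.Analysis.FluidPDE.VectorCalculus.divergence U x = 0) ∧ (∀ c : ℝ, 0 < c → ∀ x : EuclideanSpace ℝ (Fin 3), U (c • x) = c⁻¹ • U x)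 ∧ (∃ x : EuclideanSpace ℝ (Fin 3), U x ≠ 0)) → Literature.Analysis.FluidPDE.IsClassicalNSSolutionOn (Set.Ioo (-1) 0) 1 0 u p → (∀ y : EuclideanSpace ℝ (Fin 3), y ≠ 0 → Filter.Tendsto (fun t : ℝ => Real.sqrt (0 - t) • u t (Real.sqrt (0 - t) • y)) (nhdsWithin 0 (Set.Iio 0)) (nhds (U y))) → ∀ (r₀ : ℝ) (π : ℝ → EuclideanSpace ℝ (Fin 3) → ℝ), ¬ Literature.Analysis.FluidPDE.IsLocalTypeISingularPoint r₀ ((0 : ℝ), (0 : EuclideanSpace ℝ (Fin 3))) u π := by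
  intro u p U P hprof hcl htail r₀ π hT
  obtain ⟨hr₀, -, -, G, -, hI⟩ := hT
  have hC := landauTail_cknC_tendsto_top u p U P hprof hcl htail
  rw [ENNReal.tendsto_nhds_top_iff_nnreal] at hC
  refine hI.ne (ENNReal.eq_top_of_forall_nnreal_le fun M => ?_)
  obtain ⟨r, hMr, hr⟩ := ((hC M).and (Ioo_mem_nhdsGT hr₀)).exists
  calc (M : ℝ≥0∞) ≤ cknC r ((0 : ℝ), (0 : EuclideanSpace ℝ (Fin 3))) u := hMr.le
    _ ≤ abScaledSum r ((0 : ℝ), (0 : EuclideanSpace ℝ (Fin 3))) u π G := cknC_le_abScaledSum r _ u π G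
    _ ≤ typeIBound (parabolicCylinder r₀ ((0 : ℝ), (0 : EuclideanSpace ℝ (Fin 3)))) u π G :=
        abScaledSum_le_typeIBound hr.1 (parabolicCylinder_mono_radius' hr.1.le hr.2.le _)

end Summit.NavierStokesRegularity.NavierStokesRegularity.Theorems
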